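import Summits.ValiantsHypothesis.ValiantsHypothesis.Theorems.KPlusLogSqLawTropicalShiftSquare
import Summits.ValiantsHypothesis.ValiantsHypothesis.Theorems.KPlusLogSqLawTropicalShiftThreeChain
import Summits.ValiantsHypothesis.ValiantsHypothesis.Theorems.KPlusLogSqLawTropicalBSumset

/-!
# Route «KPlusLogSqLaw» — SHIFT-SQUARE, part 2: dominance, signs, the chain; the `K = 4` tropical row is at least `(m+1)² − 1`,
# and the PARALLELOGRAM row of the `K = 4` column is EXACTLY `(m+1)² − 1`

HONEST FRAMING.  Second proof file (pure theorems) of the helper chain `--supports` the crux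
`Summit.ValiantsHypothesis.ValiantsHypothesis.Theses.KPlusLogSqLaw.TropicalB` (item `stmt-ValiantsHypothesis-19771`, route `KPlusLogSqLaw`;
cell `pub-symmetroid`, seat val-sym-trop-p5 g8, 2026-08-27); design in `…TropicalShiftSquareDefs.lean`, per-incidence inequalities in
`…TropicalShiftSquare.lean`.  Proved here, sorry-free:
* `ShiftSquare.isDominant_cterm`: for ALL `p ≤ m`, `a ≤ m` the grid term `(σ_p, λ_{p,a})` is the UNIQUE optimum at the integer slope
  `θ(p,a) = 2((m+1)p + a) + 1` among all `m!·4^m` Leibniz terms (entrywise domination with a strict entry, `Finset.sum_lt_sum`);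
* `ShiftSquare.termSign_cterm`: its sign is `(−1)^{n·p + a}` — honestly, from `sign σ_p = sign(ρ^p) = ((−1)^n)^p` (Mathlib's `sign_finRotate`)
  and the `a` low-bit incidences; no phase-sign gadget;
* the square grid `grid k = (k / (m+1), k % (m+1))`, `k < (m+1)²`, has slopes `2k + 1` (`th_grid`) and signs `(−1)^k` (`termSign_grid`,
  since `(m+1)p + a ≡ n·p + a (mod 2)`);
* **`sq_sub_one_le_of_tropRootLawAt_four : TropRootLawAt m 4 B → (m+1)² − 1 ≤ B`** for every `m` — the `K = 4` tropical census row
  is at least `m² + 2m` (kernel floor of record before: `C(m+2,2) − 2`, from `K = 3`, `choose_sub_two_le_of_tropRootLawAt_four`);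
* **`parallelogram_row_four_iff`**: among `(m,4)` designs whose exponents form a parallelogram `{d₀, d₀+g₁, d₀+g₂, d₀+g₁+g₂}` a number `B`
  bounds every dominant sign-alternating chain iff `(m+1)² − 1 ≤ B` — val-sym-trop-p1's sumset ceiling
  `KPlusLogSqLaw.Sumset.chain_succ_le_parallelogram` is ATTAINED by SHIFT-SQUARE (exponents `(0, 1, D, D+1)`) at every `m`.
READING (located, not a theorem about other designs): SHIFT-SQUARE is the `ε → 0` limit of the slope type `d_(H,L) = αH + βL − εHL` of the
cell's counting-tight `(3,4)` / `(4,4)` designs (val-sym-lift-p1 g2/g3: `(0,6,15,19)`, presence RULE 1 = the presence pattern used here);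
with `ε = 0` the row is exactly quadratic, so every term of the cubic surplus `C(m+3,3) − (m+1)²` of a counting-tight `(m,4)` design is
paid for by the non-additivity of the top exponent (the `x = #HL` digit).  Nothing here bears on `TropicalB` / `WeakLifting` in their
window, on the cell's `K = 4` fork (OPEN), on `MatrixDescartes` (stmt-ValiantsHypothesis-18050) or on `VP ≠ VNP`.
-/

set_option linter.dupNamespace false
set_option autoImplicit false

namespace Summit.ValiantsHypothesis.ValiantsHypothesis.Theorems.LacunarySymmetroidMatrixDescartes.TropicalCensus

open Summit.ValiantsHypothesis.ValiantsHypothesis.Theorems.MatrixDescartes.Negative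
open scoped BigOperators
open Finset

namespace ShiftSquare

open ShiftThree (bigD shiftZ pen price th gval)

variable (n : ℕ)

/-! ### per-incidence domination -/

/-- **per-incidence domination**: at `θ(p,a)` (`p, a ≤ m`) every present incidence of column `b` scores at most the grid
term's incidence … -/
theorem phi_le (p a : ℕ) (hp : p ≤ n + 1) (ha : a ≤ n + 1) (a' b : Fin (n + 1)) (l : Fin 4)
    (h : ee n a' b l ≠ 0) :
    phi n (th n p a) a' b l ≤ phi n (th n p a) (rot n p b) b (lam n p a b) := by
  rw [phi_present n _ a' b l h, phi_cterm n _ p a hp b]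
  set q := eshift n a' b l with hq
  rcases lt_trichotomy q p with hlt | heq | hgt
  · have h1 := ShiftThree.gval_gap_of_lt n p a q hlt
    have h2 := bonus_le_of_lt n p a b l q hlt
    linarith
  · rw [heq]
    have h2 := bonus_le_of_eq n p a b l
    linarith
  · have h1 := gval_gap_of_gt n p a ha q hgt
    have h2 := bonus_le_of_gt n p a b l q hgt
    linarith

/-- … and strictly less unless it IS the grid term's incidence. -/
theorem phi_lt (p a : ℕ) (hp : p ≤ n + 1) (ha : a ≤ n + 1) (a' b : Fin (n + 1)) (l : Fin 4)
    (h : ee n a' b l ≠ 0) (hne : a' ≠ rot n p b ∨ l ≠ lam n p a b) :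
    phi n (th n p a) a' b l < phi n (th n p a) (rot n p b) b (lam n p a b) := by
  rw [phi_present n _ a' b l h, phi_cterm n _ p a hp b]
  set q := eshift n a' b l with hq
  rcases lt_trichotomy q p with hlt | heq | hgt
  · have h1 := ShiftThree.gval_gap_of_lt n p a q hlt
    have h2 := bonus_le_of_lt n p a b l q hlt
    linarith
  · -- same effective shift: same entry and same high bit, so the low bit differs
    have heq' : eshift n a' b l = p := by rw [← hq]; exact heq
    obtain ⟨ha', hhi⟩ := cell_of_eshift_eq n p hp a' b l h heq'
    have hl : l ≠ lam n p a b := by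
      rcases hne with h1 | h1
      · exact absurd ha' h1
      · exact h1
    have hlo : ¬ ((l : ℕ) % 2 = 1 ↔ (b : ℕ) < a) := by
      intro hiff
      apply hl
      apply Fin.ext
      have e1 : (l : ℕ) % 2 = ((lam n p a b : Fin 4) : ℕ) % 2 := by
        by_cases hb : (b : ℕ) < a
        · rw [hiff.mpr hb, (lam_mod_two n p a b).mpr hb]
        · have h3 : (l : ℕ) % 2 = 0 := by
            rcases Nat.mod_two_eq_zero_or_one (l : ℕ) with h4 | h4
            · exact h4
            · exact absurd (hiff.mp h4) hb
          have h4 : ((lam n p a b : Fin 4) : ℕ) % 2 = 0 := by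
            rcases Nat.mod_two_eq_zero_or_one ((lam n p a b : Fin 4) : ℕ) with h5 | h5
            · exact h5
            · exact absurd ((lam_mod_two n p a b).mp h5) hb
          rw [h3, h4]
      have e2 : (2 ≤ (l : ℕ)) ↔ (2 ≤ ((lam n p a b : Fin 4) : ℕ)) := hhi.trans (lam_high n p a b).symm
      have hl4 := l.isLt
      have hm4 := (lam n p a b).isLt
      omega
    rw [heq]
    have h2 := bonus_lt_of_eq n p a b l hlo
    linarith
  · have h1 := gval_gap_of_gt n p a ha q hgt
    have h2 := bonus_le_of_gt n p a b l q hgt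
    linarith

/-! ### dominance and signs of the grid terms -/

/-- `|lsign l| = 1`. -/
theorem lsign_natAbs (l : Fin 4) : (lsign l).natAbs = 1 := by
  unfold lsign; split_ifs <;> simp

/-- the design's signs lie in `{−1, 0, 1}`. -/
theorem ee_natAbs (a b : Fin (n + 1)) (l : Fin 4) : (ee n a b l).natAbs ≤ 1 := by
  unfold ee
  split_ifs <;> simp [lsign_natAbs]

/-- **the grid term `(σ_p, λ_{p,a})` is the unique optimum at `θ(p,a)`**, for all `p, a ≤ m`. -/
theorem isDominant_cterm (p a : ℕ) (hp : p ≤ n + 1) (ha : a ≤ n + 1) :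
    IsDominant (dd n) (vv n) (ee n) (th n p a) (cterm n p a) := by
  refine ⟨?_, ?_⟩
  · unfold termSign cterm
    refine mul_ne_zero (Units.ne_zero _) ?_
    rw [Finset.prod_ne_zero_iff]
    intro b _
    exact ee_cterm_ne_zero n p a hp b
  · intro q hq hqs
    rw [tropWeight_eq_sum_phi, tropWeight_eq_sum_phi]
    have hpres : ∀ b, ee n (q.1 b) b (q.2 b) ≠ 0 := by
      intro b
      unfold termSign at hqs
      exact (Finset.prod_ne_zero_iff.mp (right_ne_zero_of_mul hqs)) b (Finset.mem_univ b)
    obtain ⟨b₀, hb₀⟩ : ∃ b, q.1 b ≠ rot n p b ∨ q.2 b ≠ lam n p a b := by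
      by_contra hcon
      push Not at hcon
      apply hq
      unfold cterm
      exact Prod.ext (Equiv.ext fun b => (hcon b).1) (funext fun b => (hcon b).2)
    unfold cterm
    exact Finset.sum_lt_sum (fun b _ => phi_le n p a hp ha (q.1 b) b (q.2 b) (hpres b))
      ⟨b₀, Finset.mem_univ _, phi_lt n p a hp ha (q.1 b₀) b₀ (q.2 b₀) (hpres b₀) hb₀⟩

/-- the sign of the phase permutation: `sign σ_p = ((−1)^n)^p` (a power of an `m`-cycle). -/
theorem sign_rot (p : ℕ) : ((Equiv.Perm.sign (rot n p) : ℤˣ) : ℤ) = (-1) ^ (n * p) := by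
  unfold rot
  rw [map_pow, sign_finRotate, Nat.add_sub_cancel, Units.val_pow_eq_pow_val, Units.val_pow_eq_pow_val,
    Units.val_neg, Units.val_one, ← pow_mul]

/-- **sign of the grid term**: `(−1)^{n·p + a}`. -/
theorem termSign_cterm (p a : ℕ) (hp : p ≤ n + 1) (ha : a ≤ n + 1) :
    termSign (ee n) (cterm n p a) = (-1) ^ (n * p + a) := by
  unfold termSign cterm
  dsimp only
  rw [Finset.prod_congr rfl (fun b _ => ee_cterm n p a hp b), ShiftThree.prod_neg_one_pow n a ha, sign_rot,
    pow_add]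

/-! ### the chain: lexicographic enumeration of the square grid -/

/-- the grid point `k < (m+1)²` lies in the square `[0, m]²`. -/
theorem grid_le (k : ℕ) (hk : k < (n + 2) ^ 2) : (grid n k).1 ≤ n + 1 ∧ (grid n k).2 ≤ n + 1 := by
  unfold grid
  dsimp only
  constructor
  · have : k / (n + 2) < n + 2 := Nat.div_lt_of_lt_mul (by nlinarith)
    omega
  · have : k % (n + 2) < n + 2 := Nat.mod_lt _ (by omega)
    omega

/-- the slope of the `k`-th grid point is `2k + 1`: the grid slopes are the consecutive odd integers. -/
theorem th_grid (k : ℕ) : th n (grid n k).1 (grid n k).2 = 2 * k + 1 := by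
  unfold grid ShiftThree.th
  dsimp only
  have h := Nat.div_add_mod k (n + 2)
  have h' : ((n : ℤ) + 2) * (k / (n + 2) : ℕ) + (k % (n + 2) : ℕ) = k := by exact_mod_cast h
  linarith

/-- the slopes increase along the grid. -/
theorem th_grid_lt (k : ℕ) : th n (grid n k).1 (grid n k).2 < th n (grid n (k + 1)).1 (grid n (k + 1)).2 := by
  rw [th_grid, th_grid]
  push_cast
  linarith

/-- the term signs alternate along the grid: the `k`-th sign is `(−1)^k`. -/
theorem termSign_grid (k : ℕ) (hk : k < (n + 2) ^ 2) :
    termSign (ee n) (cterm n (grid n k).1 (grid n k).2) = (-1) ^ k := by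
  obtain ⟨h1, h2⟩ := grid_le n k hk
  rw [termSign_cterm n _ _ h1 h2]
  unfold grid
  dsimp only
  rw [neg_one_pow_eq_pow_mod_two, neg_one_pow_eq_pow_mod_two (R := ℤ) k]
  congr 1
  have h := Nat.div_add_mod k (n + 2)
  have h2 : (n + 2) * (k / (n + 2)) = n * (k / (n + 2)) + 2 * (k / (n + 2)) := by ring
  omega

/-- **the tropical row `(m, 4)`, `m = n + 1`, is at least `(m+1)² − 1`.** -/
theorem le_of_tropRootLawAt_four_succ (B : ℕ) (h : TropRootLawAt (n + 1) 4 B) : (n + 2) ^ 2 - 1 ≤ B := by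
  have hN : 1 ≤ (n + 2) ^ 2 := Nat.one_le_pow _ _ (by omega)
  have hmain := h (dd n) (vv n) (ee n) ((n + 2) ^ 2 - 1) (fun k => th n (grid n k).1 (grid n k).2)
    (fun k => cterm n (grid n k).1 (grid n k).2) (ee_natAbs n) ?_ ?_ ?_
  · exact hmain
  · refine Fin.strictMono_iff_lt_succ.mpr fun k => ?_
    simp only [Fin.val_castSucc, Fin.val_succ]
    exact th_grid_lt n k
  · intro k
    obtain ⟨h1, h2⟩ := grid_le n k (by omega)
    exact isDominant_cterm n _ _ h1 h2
  · intro k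
    simp only [Fin.val_castSucc, Fin.val_succ]
    rw [termSign_grid n k (by omega), termSign_grid n (k + 1) (by omega), ← pow_add,
      show (k : ℕ) + (k + 1) = 2 * k + 1 by ring, pow_succ, pow_mul]
    norm_num

end ShiftSquare

/-- **The `K = 4` tropical census row is at least `(m+1)² − 1` for EVERY `m`:** every bound `B` of the tropical row `(m, 4)`
satisfies `(m+1)² − 1 ≤ B` — the explicit SHIFT-SQUARE design has `(m+1)²` sign-alternating unique optima.  (Slope counting allows
`C(m+3,3)`; on exponent PARALLELOGRAMS such as SHIFT-SQUARE's `(0, 1, D, D+1)` it allows exactly `(m+1)²`,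
`KPlusLogSqLaw.Sumset.chain_succ_le_parallelogram`, so the design is extremal in its exponent type.) -/
theorem sq_sub_one_le_of_tropRootLawAt_four (m B : ℕ) (h : TropRootLawAt m 4 B) : (m + 1) ^ 2 - 1 ≤ B := by
  rcases m with _ | n
  · simp
  · have h1 := ShiftSquare.le_of_tropRootLawAt_four_succ n B h
    have h3 : n + 1 + 1 = n + 2 := rfl
    rw [h3]
    exact h1

namespace ShiftSquare

open ShiftThree (bigD)

variable (n : ℕ)

/-- SHIFT-SQUARE's exponents form the PARALLELOGRAM `{0, 1, D, D + 1}`: `d l = 0 + lowDigit l · 1 + highDigit l · D`. -/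
theorem dd_parallelogram (l : Fin 4) : dd n l = 0 + lowDigit l * 1 + highDigit l * bigD n := by
  fin_cases l <;> simp [dd, lowDigit, highDigit, Nat.add_comm]

/-- the low digit is at most `1`. -/
theorem lowDigit_le_one (l : Fin 4) : lowDigit l ≤ 1 := by
  unfold lowDigit; split_ifs <;> omega

/-- the high digit is at most `1`. -/
theorem highDigit_le_one (l : Fin 4) : highDigit l ≤ 1 := by
  unfold highDigit; split_ifs <;> omega

end ShiftSquare

/-- **THE PARALLELOGRAM ROW OF THE `K = 4` COLUMN IS EXACTLY `(m+1)² − 1`, for every `m`.**  Among designs of format `(m, 4)` whose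
exponents lie in a parallelogram `{d₀, d₀ + g₁, d₀ + g₂, d₀ + g₁ + g₂}` (in the digit form of
`KPlusLogSqLaw.Sumset.chain_succ_le_parallelogram`: `d l = d₀ + a₁(l)·g₁ + a₂(l)·g₂`, digits `≤ 1`), a number `B` bounds the sign changes
of every dominant sign-alternating chain iff `(m+1)² − 1 ≤ B`: the ceiling is val-sym-trop-p1's sumset law, the floor is SHIFT-SQUARE
(exponents `(0, 1, D, D+1)`).  So in this ADDITIVE exponent type the fourth class buys exactly the factor `(m+1)²/C(m+2,2) → 2` over three
classes, never a third digit; any surplus toward the slope-counting ceiling `C(m+3,3) − 1` of the full `(m, 4)` row must come from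
non-additivity `d₀ + d₃ ≠ d₁ + d₂` of the exponents. -/
theorem parallelogram_row_four_iff (m B : ℕ) :
    (∀ (d : Fin 4 → ℕ) (d₀ g₁ g₂ : ℕ) (a₁ a₂ : Fin 4 → ℕ), (∀ l, a₁ l ≤ 1) → (∀ l, a₂ l ≤ 1) →
        (∀ l, d l = d₀ + a₁ l * g₁ + a₂ l * g₂) →
        ∀ (v ε : Fin m → Fin m → Fin 4 → ℤ) (N : ℕ) (θ : Fin (N + 1) → ℤ)
          (p : Fin (N + 1) → Equiv.Perm (Fin m) × (Fin m → Fin 4)),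
          (∀ i j l, (ε i j l).natAbs ≤ 1) → StrictMono θ → (∀ k, IsDominant d v ε (θ k) (p k)) →
          (∀ k : Fin N, termSign ε (p k.castSucc) * termSign ε (p k.succ) < 0) → N ≤ B) ↔
      (m + 1) ^ 2 - 1 ≤ B := by
  constructor
  · intro h
    rcases m with _ | n
    · simp
    · have hN : 1 ≤ (n + 2) ^ 2 := Nat.one_le_pow _ _ (by omega)
      have hmain := h (ShiftSquare.dd n) 0 1 (ShiftThree.bigD n) ShiftSquare.lowDigit ShiftSquare.highDigit
        ShiftSquare.lowDigit_le_one ShiftSquare.highDigit_le_one (ShiftSquare.dd_parallelogram n)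
        (ShiftSquare.vv n) (ShiftSquare.ee n) ((n + 2) ^ 2 - 1)
        (fun k => ShiftThree.th n (ShiftSquare.grid n k).1 (ShiftSquare.grid n k).2)
        (fun k => ShiftSquare.cterm n (ShiftSquare.grid n k).1 (ShiftSquare.grid n k).2) (ShiftSquare.ee_natAbs n) ?_ ?_ ?_
      · have h3 : n + 1 + 1 = n + 2 := rfl
        rw [h3]; exact hmain
      · refine Fin.strictMono_iff_lt_succ.mpr fun k => ?_
        simp only [Fin.val_castSucc, Fin.val_succ]
        exact ShiftSquare.th_grid_lt n k
      · intro k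
        obtain ⟨h1, h2⟩ := ShiftSquare.grid_le n k (by omega)
        exact ShiftSquare.isDominant_cterm n _ _ h1 h2
      · intro k
        simp only [Fin.val_castSucc, Fin.val_succ]
        rw [ShiftSquare.termSign_grid n k (by omega), ShiftSquare.termSign_grid n (k + 1) (by omega), ← pow_add,
          show (k : ℕ) + (k + 1) = 2 * k + 1 by ring, pow_succ, pow_mul]
        norm_num
  · intro hB d d₀ g₁ g₂ a₁ a₂ h₁ h₂ hd v ε N θ p hε hθ hdom halt
    have h := KPlusLogSqLaw.Sumset.chain_succ_le_parallelogram d v ε θ p hθ hdom halt d₀ g₁ g₂ a₁ a₂ h₁ h₂ hd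
    omega

end Summit.ValiantsHypothesis.ValiantsHypothesis.Theorems.LacunarySymmetroidMatrixDescartes.TropicalCensus
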